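import Summits.MatrixMultiplication.OmegaCensus.IndepSetCert

/-!
# ω-census, family (b3): kernel-fast evaluation of the independence checkers, and composition lemmas

HONEST FRAMING (pub-omega census; verbatim): lottery ticket; floor = certified bounds/negative ranges.
Census BOOKKEEPING machinery; no value of `ω` is touched here.  Continues `IndepSetCert.lean`.

1. **Fast variants.**  `mcq` / `Cert.check` remove vertices from a candidate mask with `Nat.ldiff`, which the kernel evaluates
   bit by bit (`Nat.bitwise`); the variants `mcqF` / `Cert.checkF` below are the SAME functions with `P.ldiff M` spelled
   `sdiff P M = P ^^^ (P &&& M)` (two GMP-accelerated kernel operations).  `sdiff_eq`, `mcqF_eq`, `Cert.checkF_eq` prove the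
   variants equal to the originals, so soundness transfers verbatim (`Cert.soundF`); measured kernel speed-up ≈ 2.5× on the
   `Dic₃` boxes.
2. **Composition.**  `NoIndep adj n P k` ("every `adj`-independent set of vertices `< n` inside the mask `P` has `< k` elements")
   lets one certificate be checked as several kernel evaluations: `noIndep_of_checkF` turns one `Cert.checkF … = true` (with any
   vertex order `vs` listing all of `range n`) into `NoIndep`, and `NoIndep.br` is the branching step "vertex `v` in / out" at
   the level of propositions, so the top of a large search tree can be written as a term while its subtrees are separate
   `decide` evaluations, each within default-sized heartbeat budgets.
-/

open Finset

namespace Summit.MatrixMultiplication.OmegaCensus.IndepSearch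

/-! ## Fast variants -/

/-- Mask difference `P \ M` through kernel-accelerated operations: `P ^^^ (P &&& M)`. [folklore] -/
def sdiff (P M : ℕ) : ℕ := P ^^^ (P &&& M)

/-- `sdiff` is `Nat.ldiff`. [folklore] -/
theorem sdiff_eq (P M : ℕ) : sdiff P M = P.ldiff M :=
  Nat.eq_of_testBit_eq fun i => by
    simp only [sdiff, Nat.testBit_xor, Nat.testBit_land, Nat.testBit_ldiff]
    cases P.testBit i <;> cases M.testBit i <;> rfl

/-- `mcqV` with `sdiff`. [folklore] -/
def mcqVF (adj : ℕ → ℕ) (rec : ℕ → Bool) (B : ℕ) : List ℕ → ℕ → Bool × ℕ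
  | [], P => (true, P)
  | v :: rest, P =>
      if B.testBit v && P.testBit v then
        if rec (sdiff (sdiff P (adj v)) (2 ^ v)) then mcqVF adj rec B rest (sdiff P (2 ^ v)) else (false, P)
      else mcqVF adj rec B rest P

/-- `mcqB` with `sdiff`. [folklore] -/
def mcqBF (adj : ℕ → ℕ) (rec : ℕ → Bool) (vs : List ℕ) : List ℕ → ℕ → Bool
  | [], _ => true
  | B :: Bs, P => (mcqVF adj rec B vs P).1 && mcqBF adj rec vs Bs (mcqVF adj rec B vs P).2

/-- `mcq` with `sdiff`. [folklore] -/
def mcqF (adj : ℕ → ℕ) (vs : List ℕ) : ℕ → ℕ → Bool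
  | 0, _ => false
  | k + 1, P =>
      let blocks := ffBlocks adj P vs []
      if blocks.length ≤ k then true else mcqBF adj (mcqF adj vs k) vs ((blocks.drop k).reverse) P

/-- `Cert.check` with `sdiff` and `mcqF`. [folklore] -/
def Cert.checkF (adj tab : ℕ → ℕ) (m : ℕ) (vs : List ℕ) : Cert → ℕ → ℕ → Bool
  | cov L, P, k => decide (L.length < k) && L.all (· < m) && (P &&& covMask tab L == P)
  | fcov D L, P, k =>
      decide (wsum L < k * D) && L.all (fun iw => iw.1 < m) && vs.all fun v => !P.testBit v || decide (D ≤ wdeg tab v L)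
  | br _ _ _, _, 0 => false
  | br v cin cout, P, k + 1 =>
      P.testBit v && cin.checkF adj tab m vs (sdiff (sdiff P (adj v)) (2 ^ v)) k && cout.checkF adj tab m vs (sdiff P (2 ^ v)) (k + 1)
  | auto, P, k => mcqF adj vs k P

/-- `mcqVF = mcqV`. [folklore] -/
theorem mcqVF_eq (adj : ℕ → ℕ) (rec : ℕ → Bool) (B : ℕ) : ∀ (l : List ℕ) (P : ℕ), mcqVF adj rec B l P = mcqV adj rec B l P
  | [], _ => rfl
  | v :: rest, P => by simp only [mcqVF, mcqV, sdiff_eq, mcqVF_eq adj rec B rest]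

/-- `mcqBF = mcqB`. [folklore] -/
theorem mcqBF_eq (adj : ℕ → ℕ) (rec : ℕ → Bool) (vs : List ℕ) : ∀ (Bs : List ℕ) (P : ℕ), mcqBF adj rec vs Bs P = mcqB adj rec vs Bs P
  | [], _ => rfl
  | B :: Bs, P => by simp only [mcqBF, mcqB, mcqVF_eq, mcqBF_eq adj rec vs Bs]

/-- `mcqF = mcq`. [folklore] -/
theorem mcqF_eq (adj : ℕ → ℕ) (vs : List ℕ) : ∀ (k P : ℕ), mcqF adj vs k P = mcq adj vs k P
  | 0, _ => rfl
  | k + 1, P => by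
      have ih : mcqF adj vs k = mcq adj vs k := funext (mcqF_eq adj vs k)
      simp only [mcqF, mcq, ih, mcqBF_eq]

/-- `Cert.checkF = Cert.check`. [folklore] -/
theorem Cert.checkF_eq (adj tab : ℕ → ℕ) (m : ℕ) (vs : List ℕ) :
    ∀ (c : Cert) (P k : ℕ), c.checkF adj tab m vs P k = c.check adj tab m vs P k
  | cov _, _, _ => rfl
  | fcov _ _, _, _ => rfl
  | br _ _ _, _, 0 => rfl
  | br v cin cout, P, k + 1 => by
      simp only [Cert.checkF, Cert.check, sdiff_eq, Cert.checkF_eq adj tab m vs cin, Cert.checkF_eq adj tab m vs cout]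
  | auto, P, k => mcqF_eq adj vs k P

/-- **Soundness of the fast checker** (transferred from `Cert.sound`). [folklore] -/
theorem Cert.soundF {adj tab : ℕ → ℕ} {m n : ℕ} {vs : List ℕ} (htab : tabOK adj tab m n = true) (c : Cert) (P k : ℕ)
    (h : c.checkF adj tab m vs P k = true) :
    ∀ I : Finset ℕ, IndepN adj I → (∀ a ∈ I, a ∈ vs ∧ P.testBit a = true) → I.card < k :=
  Cert.sound htab c P k (by rwa [Cert.checkF_eq] at h)

/-! ## Composition -/

/-- `NoIndep adj n P k`: every `adj`-independent set of vertices `< n` inside the mask `P` has fewer than `k` elements. [folklore] -/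
def NoIndep (adj : ℕ → ℕ) (n P k : ℕ) : Prop :=
  ∀ I : Finset ℕ, IndepN adj I → (∀ a ∈ I, a < n ∧ P.testBit a = true) → I.card < k

/-- A vertex order `vs` LISTS `range n` when every `a < n` occurs in it (Boolean form, checked by `decide`). [folklore] -/
def listsRange (vs : List ℕ) (n : ℕ) : Bool := (List.range n).all fun a => vs.elem a

/-- `List.range n` lists `range n`. [folklore] -/
theorem listsRange_range (n : ℕ) : listsRange (List.range n) n = true := by
  simp [listsRange, List.all_eq_true]

/-- **Bridge.** One kernel evaluation of the fast checker, in any vertex order listing `range n`, gives `NoIndep`. [folklore] -/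
theorem noIndep_of_checkF {adj tab : ℕ → ℕ} {m n : ℕ} {vs : List ℕ} (hvs : listsRange vs n = true)
    (htab : tabOK adj tab m n = true) (c : Cert) {P k : ℕ} (h : c.checkF adj tab m vs P k = true) : NoIndep adj n P k := by
  intro I hI hsub
  simp only [listsRange, List.all_eq_true, List.mem_range, List.elem_iff] at hvs
  exact Cert.soundF htab c P k h I hI fun a ha => ⟨hvs a (hsub a ha).1, (hsub a ha).2⟩

/-- **Branching step at the level of propositions**: if `v ∈ P`, no independent `k`-set among the non-neighbours of `v` in `P`,
and no independent `(k+1)`-set in `P ∖ {v}`, then no independent `(k+1)`-set in `P`.  The two masks are taken as data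
(`Pin`, `Pout`) with their defining equations, so that instances can state them as literals. [folklore] -/
theorem NoIndep.br {adj : ℕ → ℕ} {n P k : ℕ} (v Pin Pout : ℕ) (hin_eq : Pin = sdiff (sdiff P (adj v)) (2 ^ v))
    (hout_eq : Pout = sdiff P (2 ^ v)) (hin : NoIndep adj n Pin k) (hout : NoIndep adj n Pout (k + 1)) :
    NoIndep adj n P (k + 1) := by
  classical
  intro I hI hsub
  subst hin_eq hout_eq
  by_cases hvI : v ∈ I
  · have hrest : (I.erase v).card < k := by
      refine hin (I.erase v) (fun a ha b hb hab => hI a (Finset.mem_of_mem_erase ha) b (Finset.mem_of_mem_erase hb) hab)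
        fun a ha => ?_
      have hav : a ≠ v := Finset.ne_of_mem_erase ha
      have haI := Finset.mem_of_mem_erase ha
      refine ⟨(hsub a haI).1, ?_⟩
      rw [sdiff_eq, sdiff_eq, Nat.testBit_ldiff, Nat.testBit_ldiff, Nat.testBit_two_pow, (hsub a haI).2,
        hI v hvI a haI (Ne.symm hav)]
      simp [Ne.symm hav]
    have := Finset.card_erase_add_one hvI
    omega
  · refine hout I hI fun a ha => ⟨(hsub a ha).1, ?_⟩
    have hav : a ≠ v := fun e => hvI (e ▸ ha)
    rw [sdiff_eq, Nat.testBit_ldiff, Nat.testBit_two_pow, (hsub a ha).2]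
    simp [Ne.symm hav]

/-- Shrinking the mask keeps `NoIndep`. [folklore] -/
theorem NoIndep.mono {adj : ℕ → ℕ} {n P P' k : ℕ} (h : NoIndep adj n P k) (hsub : P' &&& P = P') : NoIndep adj n P' k :=
  fun I hI hI' => h I hI fun a ha => ⟨(hI' a ha).1, testBit_of_land_eq hsub (hI' a ha).2⟩

/-- Weakening the bound keeps `NoIndep`. [folklore] -/
theorem NoIndep.of_le {adj : ℕ → ℕ} {n P k k' : ℕ} (h : NoIndep adj n P k) (hk : k ≤ k') : NoIndep adj n P k' :=
  fun I hI hI' => lt_of_lt_of_le (h I hI hI') hk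

end Summit.MatrixMultiplication.OmegaCensus.IndepSearch
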